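import Literature.AlgebraicGeometry.Resolution.TameDescentTrace
import Literature.AlgebraicGeometry.Resolution.ApproximationDegreeOneGenerates
import Literature.AlgebraicGeometry.Resolution.HenselLift
import Mathlib.FieldTheory.Relrank
import HarnessLib

/-!
# The pull-down of henselian rationality through a tame root layer (Kuhlmann–Vlahu 2014, Thm. 14.5)

Topic: `Literature/AlgebraicGeometry/Resolution` (valued function fields). F.-V. Kuhlmann,
I. Vlahu, *The relative approximation degree in valued function fields*, Math. Z. 276 (2014) =
arXiv:1304.0200, §14:

> **Theorem 14.5.** Let `(K,v)` be an algebraically maximal field of rank 1, and let `(F,v)` be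
> an immediate function field of transcendence degree 1 over `(K,v)`, with `F ⊄ K^c`. If `F^h.L`
> is a henselian rational function field over `L` for some tame extension `(L|K,v)`, then `F^h`
> is a henselian rational function field over `K`.
> *Proof.* … there is some `d ∈ L` such that for `y := Tr(d·x) ∈ F^h` we have `𝐡_K(x:y) = 1`. By
> virtue of Corollary 10.8, `L(y)^h = L(x)^h`. From Lemma 14.2, we can now infer that `F^h` is
> henselian rational over `K`.
> **Lemma 14.2.** If there exists an element `y ∈ F^h` such that `L(y)^h = L(x)^h`, then
> `F^h = K(y)^h`. [`[F^h.L : F^h] = [L:K] = [K(y)^h.L : K(y)^h]` … `F^h.L = L(y)^h = K(y)^h.L`.]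

This is the algebraic counterpart of the descent step of M. Temkin, *Inseparable local
uniformization*, J. Algebra 373 (2013), Thm. 3.2.3, Step 1 ("by [Duc]"), on the way to
Thm. 3.3.1 = the named fact `Temkin2013RelativeCurveSmoothFibre`. This file PROVES it in the
setting of `TameDescentTrace.lean` (module docstring there): `C ≤ E` inside the algebraically
closed `(Ω, V)` of characteristic `p`, `C` perfect, henselian, of rank one and algebraically
closed in the henselian `E`, `(E|C)` immediate (which replaces "algebraically maximal":
`E` is then `C`-split, Temkin 2013 Cor. 3.1.10); the tame ROOT LAYER `L = C(roots P)` with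
trivial ramification group (Kuhlmann–Vlahu Thm. 13.2) in place of the tame `L`; `M = E·L`; a
generator `x ∈ M`, transcendental, not a limit of elements of `L` ("`F ⊄ K^c`", Lemma 14.1), with
`M ⊆ L(x)^h`. Conclusion (`le_henselization_of_rootLayer`): **`E ≤ C(y)^h` for some `y ∈ E`
transcendental over `C`.**

Proof: `y = Tr(d x)` with `𝐡_L(x:y) = 1` (`exists_good_trace`, Lemma 14.4); then
`x ∈ L(y)^h` by Prop. 10.5 in degree one (`mem_henselization_of_degree_one`), whose
separability hypothesis — `x` separable over `L(y)^h` — is established here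
(`isSeparable_of_good_approximant`, the content of Thm. 10.7 / Cor. 10.8 in degree one: were
`x` inseparable over `N = L(y)^h`, then `[N(x) : N(x^p)] = p`, so `N ⊆ L(x^p)^h` by counting
degrees under `M = L(x^p)^h(x)`, so `y ∈ L(x^p)^h` would have a good approximant `g(x^p)`,
of relative approximation degree divisible by `p` at `x` — contradicting `𝐡_L(x:y) = 1`,
Lemma 7.2 and the uniqueness of `𝐡`); hence `M = L(y)^h = C(y)^h·L`, and Lemma 14.2's degree
count `[M : E] = [L : C] = [C(y)^h·L : C(y)^h]` (`RelAlgClosedRootLayers.lean`) gives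
`E = C(y)^h`.

## Content (PROVED; no definitions, no named facts)

* `isSeparable_of_good_approximant` — the generator is separable over `L(y)^h`
  [cite: KuhlmannVlahu2014, Thm. 10.7 and Cor. 10.8].
* `le_henselization_of_rootLayer` — **Thm. 14.5 with Lemma 14.2 for a tame root layer**
  [cite: KuhlmannVlahu2014, Thm. 14.5] [cite: Temkin2013, Thm. 3.2.3 (Step 1)].

## Sources

* F.-V. Kuhlmann, I. Vlahu, Math. Z. 276 (2014) = arXiv:1304.0200, §10 (Lemma 10.1,
  Prop. 10.5, Lemma 10.6, Thm. 10.7, Cor. 10.8), §14 (Lemmas 14.1–14.4, Thm. 14.5), pp. 18–26.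
  [KuhlmannVlahu2014]
* M. Temkin, J. Algebra 373 (2013) = arXiv:0804.1554, Thm. 3.2.3, Step 1. [Temkin2013]
-/

noncomputable section

open Polynomial Finset IsLocalRing IntermediateField Module

namespace Literature.AlgebraicGeometry.Resolution

universe u

variable {Ω : Type u} [Field Ω] [IsAlgClosed Ω] (V : ValuationSubring Ω)

/-! ### Degrees of subfields: two small helpers -/

section Degrees

omit [IsAlgClosed Ω]

/-- The relative degree `[K(x) : K]` of a simple extension inside `Ω` is the degree of the
minimal polynomial. [folklore] -/
theorem relfinrank_closure_singleton (K : Subfield Ω) {x : Ω} (hx : IsIntegral K x) :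
    Subfield.relfinrank K (Subfield.closure ((K : Set Ω) ∪ {x})) = (minpoly K x).natDegree := by
  have hle : K ≤ Subfield.closure ((K : Set Ω) ∪ {x}) := fun c hc => Subfield.subset_closure (Or.inl hc)
  rw [Subfield.relfinrank_eq_finrank_of_le hle]
  have heq : Subfield.extendScalars hle = IntermediateField.adjoin K ({x} : Set Ω) := by
    apply IntermediateField.ext
    intro w
    rw [Subfield.mem_extendScalars, mem_adjoin_subfield_iff]
  rw [heq, IntermediateField.adjoin.finrank hx]

/-- **Tower comparison**: for subfields `A ≤ B ≤ C'` of `Ω` with `[C' : A] = m`,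
`0 < m ≤ n`, and `[C' : B] = n`, necessarily `B = A` (`[B : A] · n = m ≤ n`). [folklore] -/
theorem le_of_relfinrank_mul {A B C' : Subfield Ω} (hAB : A ≤ B) (hBC : B ≤ C') {m n : ℕ}
    (hm : 0 < m) (hmn : m ≤ n) (hAC : Subfield.relfinrank A C' = m)
    (hBC' : Subfield.relfinrank B C' = n) : B ≤ A := by
  have htower := Subfield.relfinrank_mul_relfinrank hAB hBC
  rw [hBC', hAC] at htower
  -- `relfinrank A B * n = m ≤ n`, `0 < m`
  have h3 : Subfield.relfinrank A B ≠ 0 := by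
    intro h0
    rw [h0, zero_mul] at htower
    omega
  have h2 : Subfield.relfinrank A B ≤ 1 := by
    by_contra h
    push Not at h
    have : 2 * n ≤ Subfield.relfinrank A B * n := Nat.mul_le_mul_right n h
    omega
  have h4 : Subfield.relfinrank A B = 1 := by omega
  exact Subfield.relfinrank_eq_one_iff.mp h4

end Degrees


/-! ### The hypotheses (10.1) in the abstract split setting -/

section Split

variable (p : ℕ) [hp : Fact p.Prime] [CharP Ω p] [CharP (ResidueField V) p]

/-- **The hypotheses (10.1) over `K` for transcendental elements of `M`**, abstract form of
`kaplansky_rootLayer`: `K ≤ M ≤ Ω` with `K` perfect, henselian, of rank one, `M` henselian,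
every element of `M` algebraic over `K` in `K`, `(M|K)` immediate; then a `z ∈ M` transcendental
over `K` is transcendental in polynomial form, `(K(z)|K)` is immediate and of rank one, and `z`
has transcendental approximation type over `K` (`M` is `K`-split, Temkin 2013 Cor. 3.1.10).
[folklore] -/
theorem kaplansky_of_split {K M : Subfield Ω} (hKM : K ≤ M)
    (hK : IsHenselianField K (V.comap (algebraMap K Ω))) (hperf : ∀ y ∈ K, ∃ b ∈ K, b ^ p = y)
    (hr1 : IsRankOneValued V K) (hM : IsHenselianField M (V.comap (algebraMap M Ω)))
    (hrel : ∀ a ∈ M, IsAlgebraic K a → a ∈ K) (himm : IsImmediateOver V K M)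
    {z : Ω} (hzM : z ∈ M) (hzt : Transcendental K z) :
    (∀ Q : Polynomial Ω, (∀ k, Q.coeff k ∈ K) → Q.eval z = 0 → Q = 0) ∧
    IsImmediateOver V K (Subfield.closure ((K : Set Ω) ∪ {z})) ∧
    IsRankOneValued V (Subfield.closure ((K : Set Ω) ∪ {z})) ∧
    (∀ g : Polynomial Ω, (∀ k, g.coeff k ∈ K) → ∃ a₀ ∈ K, ∃ α : V.ValueGroup,
      ∀ a ∈ K, V.valuation (z - a) ≤ V.valuation (z - a₀) → V.valuation (g.eval a) = α) := by
  have htrans := forall_eval_eq_zero_imp_of_transcendental hzt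
  set Kz : Subfield Ω := Subfield.closure ((K : Set Ω) ∪ {z}) with hKz
  have hKzM : Kz ≤ M := Subfield.closure_le.mpr (Set.union_subset hKM (Set.singleton_subset_iff.mpr hzM))
  have himmz : IsImmediateOver V K Kz := himm.mono_right hKzM
  have hr1z : IsRankOneValued V Kz := hr1.of_isImmediateOver
    (fun c hc => Subfield.subset_closure (Or.inl hc)) himmz
  have hsplit : ∀ θ g : Ω, IsAlgebraic K θ → IsAlgebraic K g →
      (∀ c ∈ K, V.valuation g ≤ V.valuation (z - c)) → V.valuation g ≤ V.valuation (z - θ) :=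
    fun θ g hθ hg hfar =>
      valuation_le_sub_of_forall_isAlgebraic_mem_of_perfect V p hKM hK hperf hr1 hM hrel hzM hθ hg hfar
  exact ⟨htrans, himmz, hr1z, kaplansky_condition_of_split V K htrans himmz hsplit⟩

/-- **The generator is separable over `K(y)^h`** (the content of Kuhlmann–Vlahu 2014, Thm. 10.7 /
Cor. 10.8 in relative approximation degree one). Setting: `K ≤ M` as in `kaplansky_of_split`;
`x ∈ M` transcendental over `K`, not a limit of elements of `K`, with `M ⊆ K(x)^h`; `y ∈ M` with
a GOOD approximant `g(x)`, `g` over `K`, of relative approximation degree `1` at `x`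
(`|g(x) − g(c)| = β|x − c|` for `c ↗ x`). Then `x` is separable over `N = K(y)^h`. PROVED: were it
not, the minimal polynomial of `x` over `N` is a polynomial in `X^p`, whence `x ∉ N(x^p)` and
`[N(x) : N(x^p)] = p`; as `N(x) = M ⊇ N(x^p) ⊇ K(x^p)^h` with `[M : K(x^p)^h] ≤ p`, we get
`N ⊆ K(x^p)^h`, so `y` has approximants `h(x^p)`, `h` over `K`, as good as we please (density,
Lemma 10.1); such an approximant has the same `(β, 𝐡)` at `x` as `g` (Lemma 7.2), i.e. `𝐡 = 1`,
but `|h(x^p) − h(c^p)| = β' |x − c|^{p·𝐡'}` (`K` is perfect: `c ↦ c^p` is onto `K`) — contradicting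
the uniqueness of `𝐡`. [cite: KuhlmannVlahu2014, Thm. 10.7 and Cor. 10.8] -/
theorem isSeparable_of_good_approximant {K M : Subfield Ω} (hKM : K ≤ M)
    (hK : IsHenselianField K (V.comap (algebraMap K Ω))) (hperf : ∀ y ∈ K, ∃ b ∈ K, b ^ p = y)
    (hr1 : IsRankOneValued V K) (hM : IsHenselianField M (V.comap (algebraMap M Ω)))
    (hrel : ∀ a ∈ M, IsAlgebraic K a → a ∈ K) (himm : IsImmediateOver V K M)
    {x : Ω} (hxM : x ∈ M) (hxt : Transcendental K x)
    (hMx : M ≤ henselization V (Subfield.closure ((K : Set Ω) ∪ {x})))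
    {y : Ω} (hyM : y ∈ M)
    {g : Polynomial Ω} (hgK : ∀ k, g.coeff k ∈ K)
    (hgood : ∀ b ∈ K, V.valuation (y - g.eval x) < V.valuation (y - b))
    {β : V.ValueGroup} (hβ : β ≠ 0) {a₀ : Ω} (ha₀K : a₀ ∈ K)
    (hlin : ∀ c ∈ K, V.valuation (x - c) ≤ V.valuation (x - a₀) →
      V.valuation (g.eval x - g.eval c) = β * V.valuation (x - c) ^ 1)
    (hex : ∃ e ∈ K, e ≠ 0 ∧ ∀ b ∈ K, V.valuation e ≤ V.valuation (x - b)) :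
    IsSeparable (henselization V (Subfield.closure ((K : Set Ω) ∪ {y}))) x := by
  classical
  have hp1 : 1 < p := hp.out.one_lt
  -- notation
  set Kx : Subfield Ω := Subfield.closure ((K : Set Ω) ∪ {x}) with hKxdef
  set Ky : Subfield Ω := Subfield.closure ((K : Set Ω) ∪ {y}) with hKydef
  set N : Subfield Ω := henselization V Ky with hNdef
  have hKKx : K ≤ Kx := fun c hc => Subfield.subset_closure (Or.inl hc)
  have hxKx : x ∈ Kx := Subfield.subset_closure (Or.inr rfl)
  have hKKy : K ≤ Ky := fun c hc => Subfield.subset_closure (Or.inl hc)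
  have hyKy : y ∈ Ky := Subfield.subset_closure (Or.inr rfl)
  have hKxM : Kx ≤ M := Subfield.closure_le.mpr (Set.union_subset hKM (Set.singleton_subset_iff.mpr hxM))
  have hKyM : Ky ≤ M := Subfield.closure_le.mpr (Set.union_subset hKM (Set.singleton_subset_iff.mpr hyM))
  have hKyN : Ky ≤ N := le_henselization V Ky
  have hNM : N ≤ M := henselization_le_of_isHenselianField V Ky hKyM hM
  have hKN : K ≤ N := hKKy.trans hKyN
  have hyN : y ∈ N := hKyN hyKy
  have hN : IsHenselianField N (V.comap (algebraMap N Ω)) := Kuhlmann2010HenselizationIsHenselian_holds Ω V Ky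
  have hHxM : henselization V Kx ≤ M := henselization_le_of_isHenselianField V Kx hKxM hM
  -- (10.1) for `x`
  obtain ⟨htransx, himmx, hr1x, h3x⟩ := kaplansky_of_split V p hKM hK hperf hr1 hM hrel himm hxM hxt
  have hxK : x ∉ K := not_mem_of_forall_eval_eq_zero K htransx
  have hvalx := himmx.1
  have hresx := hres_of_isImmediateOver V himmx
  have hxc0 : ∀ c ∈ K, V.valuation (x - c) ≠ 0 := fun c hc =>
    (_root_.map_ne_zero _).mpr fun h0 => hxK (by rw [sub_eq_zero.mp h0]; exact hc)
  -- `y` is transcendental over `K`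
  have hyK : y ∉ K := fun hy => by
    have h := hgood y hy
    rw [sub_self, map_zero] at h
    exact not_lt_zero h
  have hyt : Transcendental K y := fun halg => hyK (hrel y hyM halg)
  -- `x` is algebraic over `K(y)`, hence integral over `N`
  have halgx : ∀ z ∈ M, IsAlgebraic (IntermediateField.adjoin K ({x} : Set Ω)) z := by
    intro z hz
    rw [← isAlgebraic_closure_iff]
    exact (isSeparable_of_mem_henselization V Kx (hMx hz)).isIntegral.isAlgebraic
  have halgy : ∀ z ∈ M, IsAlgebraic (IntermediateField.adjoin K ({y} : Set Ω)) z :=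
    isAlgebraic_adjoin_singleton_of_transcendental hKM hxM hyM hyt halgx
  have hxN : IsIntegral N x := by
    have h1 : IsAlgebraic Ky x := (isAlgebraic_closure_iff K {y} x).mpr (halgy x hxM)
    exact (isAlgebraic_of_subfield_le hKyN h1).isIntegral
  -- suppose `x` is not separable over `N`
  by_contra hns
  obtain hsep | ⟨-, g₁, hg₁irr, hg₁⟩ := Polynomial.separable_or p (minpoly.irreducible hxN)
  · exact hns hsep
  -- `x^p` is a root of `g₁`
  have hg₁0 : g₁ ≠ 0 := hg₁irr.ne_zero
  have hg₁x : aeval (x ^ p) g₁ = 0 := by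
    rw [← Polynomial.expand_aeval p g₁ x, hg₁]
    exact minpoly.aeval N x
  have hdegq : (minpoly N x).natDegree = p * g₁.natDegree := by
    rw [← hg₁, Polynomial.natDegree_expand, mul_comm]
  -- the fields `N(x)`, `N(x^p)`, `K(x^p)^h`
  set z : Ω := x ^ p with hzdef
  set Nx : Subfield Ω := Subfield.closure ((N : Set Ω) ∪ {x}) with hNxdef
  set Nz : Subfield Ω := Subfield.closure ((N : Set Ω) ∪ {z}) with hNzdef
  set Kz : Subfield Ω := Subfield.closure ((K : Set Ω) ∪ {z}) with hKzdef
  set M₁ : Subfield Ω := henselization V Kz with hM₁def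
  have hzM : z ∈ M := by rw [hzdef]; exact pow_mem hxM p
  have hNNx : N ≤ Nx := fun c hc => Subfield.subset_closure (Or.inl hc)
  have hNNz : N ≤ Nz := fun c hc => Subfield.subset_closure (Or.inl hc)
  have hxNx : x ∈ Nx := Subfield.subset_closure (Or.inr rfl)
  have hzNz : z ∈ Nz := Subfield.subset_closure (Or.inr rfl)
  have hzNx : z ∈ Nx := by rw [hzdef]; exact pow_mem hxNx p
  have hNzNx : Nz ≤ Nx := Subfield.closure_le.mpr (Set.union_subset hNNx (Set.singleton_subset_iff.mpr hzNx))
  have hNxM : Nx ≤ M := Subfield.closure_le.mpr (Set.union_subset hNM (Set.singleton_subset_iff.mpr hxM))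
  have hNzM : Nz ≤ M := hNzNx.trans hNxM
  have hKKz : K ≤ Kz := fun c hc => Subfield.subset_closure (Or.inl hc)
  have hzKz : z ∈ Kz := Subfield.subset_closure (Or.inr rfl)
  have hKzM : Kz ≤ M := Subfield.closure_le.mpr (Set.union_subset hKM (Set.singleton_subset_iff.mpr hzM))
  have hKzM₁ : Kz ≤ M₁ := le_henselization V Kz
  have hM₁M : M₁ ≤ M := henselization_le_of_isHenselianField V Kz hKzM hM
  have hM₁ : IsHenselianField M₁ (V.comap (algebraMap M₁ Ω)) := Kuhlmann2010HenselizationIsHenselian_holds Ω V Kz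
  -- `N(x)` and `N(z)` are henselian (finite over `N`)
  have hzN : IsIntegral N z := by rw [hzdef]; exact hxN.pow p
  have hNxalg : ∀ w ∈ Nx, IsAlgebraic N w := fun w hw =>
    isAlgebraic_of_mem_closure (fun v hv => by rw [Set.mem_singleton_iff.mp hv]; exact hxN.isAlgebraic) hw
  have hNzalg : ∀ w ∈ Nz, IsAlgebraic N w := fun w hw =>
    isAlgebraic_of_mem_closure (fun v hv => by rw [Set.mem_singleton_iff.mp hv]; exact hzN.isAlgebraic) hw
  have hNxh : IsHenselianField Nx (V.comap (algebraMap Nx Ω)) := IsHenselianField.of_subfield_algebraic V hNNx hNxalg hN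
  have hNzh : IsHenselianField Nz (V.comap (algebraMap Nz Ω)) := IsHenselianField.of_subfield_algebraic V hNNz hNzalg hN
  -- (a) `N(x) = M`
  have hKxNx : Kx ≤ Nx := Subfield.closure_le.mpr (Set.union_subset (hKN.trans hNNx) (Set.singleton_subset_iff.mpr hxNx))
  have hMNx : M ≤ Nx := hMx.trans (henselization_le_of_isHenselianField V Kx hKxNx hNxh)
  have hNxeq : Nx = M := le_antisymm hNxM hMNx
  -- (b) `M₁ ≤ N(z)`
  have hKzNz : Kz ≤ Nz := Subfield.closure_le.mpr (Set.union_subset (hKN.trans hNNz) (Set.singleton_subset_iff.mpr hzNz))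
  have hM₁Nz : M₁ ≤ Nz := henselization_le_of_isHenselianField V Kz hKzNz hNzh
  -- (c) `[M : M₁] = deg minpoly_{M₁} x ≤ p`, and `M = M₁(x)`
  set M₁x : Subfield Ω := Subfield.closure ((M₁ : Set Ω) ∪ {x}) with hM₁xdef
  have hxM₁ : IsIntegral M₁ x := by
    -- `x` is a root of `X^p - z` over `M₁`
    refine ⟨Polynomial.X ^ p - Polynomial.C ⟨z, hKzM₁ hzKz⟩, ?_, ?_⟩
    · exact Polynomial.monic_X_pow_sub_C _ hp.out.ne_zero
    · rw [Polynomial.eval₂_sub, Polynomial.eval₂_X_pow, Polynomial.eval₂_C]; exact sub_self _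
  have hM₁xalg : ∀ w ∈ M₁x, IsAlgebraic M₁ w := fun w hw =>
    isAlgebraic_of_mem_closure (fun v hv => by rw [Set.mem_singleton_iff.mp hv]; exact hxM₁.isAlgebraic) hw
  have hM₁xh : IsHenselianField M₁x (V.comap (algebraMap M₁x Ω)) :=
    IsHenselianField.of_subfield_algebraic V (fun c hc => Subfield.subset_closure (Or.inl hc)) hM₁xalg hM₁
  have hKxM₁x : Kx ≤ M₁x := Subfield.closure_le.mpr (Set.union_subset
    (fun c hc => Subfield.subset_closure (Or.inl (hKzM₁ (hKKz hc)))) (Set.singleton_subset_iff.mpr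
      (Subfield.subset_closure (Or.inr rfl))))
  have hMM₁x : M ≤ M₁x := hMx.trans (henselization_le_of_isHenselianField V Kx hKxM₁x hM₁xh)
  have hM₁xM : M₁x ≤ M := Subfield.closure_le.mpr (Set.union_subset hM₁M (Set.singleton_subset_iff.mpr hxM))
  have hM₁xeq : M₁x = M := le_antisymm hM₁xM hMM₁x
  have hdegM : Subfield.relfinrank M₁ M = (minpoly M₁ x).natDegree := by
    rw [← hM₁xeq]; exact relfinrank_closure_singleton M₁ hxM₁
  have hdegM_le : (minpoly M₁ x).natDegree ≤ p := by
    have hdvd : minpoly M₁ x ∣ Polynomial.X ^ p - Polynomial.C ⟨z, hKzM₁ hzKz⟩ :=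
      minpoly.dvd M₁ x (by rw [map_sub, map_pow, aeval_X, aeval_C]; exact sub_self _)
    have hne : (Polynomial.X ^ p - Polynomial.C (⟨z, hKzM₁ hzKz⟩ : M₁)) ≠ 0 :=
      (Polynomial.monic_X_pow_sub_C _ hp.out.ne_zero).ne_zero
    exact (Polynomial.natDegree_le_of_dvd hdvd hne).trans (Polynomial.natDegree_X_pow_sub_C (n := p) (r := _)).le
  have hdegM_pos : 0 < (minpoly M₁ x).natDegree := minpoly.natDegree_pos hxM₁
  -- (d1) `x ∉ N(z)`
  have hxNz : x ∉ Nz := by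
    intro hxNz'
    -- then `N(x) = N(z)`, and degrees over `N` disagree
    have hNxNz : Nx ≤ Nz := Subfield.closure_le.mpr (Set.union_subset hNNz (Set.singleton_subset_iff.mpr hxNz'))
    have heq : Nx = Nz := le_antisymm hNxNz hNzNx
    have h1 : Subfield.relfinrank N Nx = p * g₁.natDegree := by
      rw [relfinrank_closure_singleton N hxN, hdegq]
    have h2 : Subfield.relfinrank N Nz ≤ g₁.natDegree := by
      rw [relfinrank_closure_singleton N hzN]
      exact Polynomial.natDegree_le_of_dvd (minpoly.dvd N z hg₁x) hg₁0
    rw [heq] at h1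
    have hg₁deg : 0 < g₁.natDegree := by
      by_contra h0
      have h0' : g₁.natDegree = 0 := Nat.eq_zero_of_not_pos h0
      rw [h0', mul_zero] at hdegq
      exact absurd hdegq (minpoly.natDegree_pos hxN).ne'
    have : p * g₁.natDegree ≤ g₁.natDegree := h1 ▸ h2
    nlinarith
  -- (d2) `[N(x) : N(z)] = p`
  have hxNz_int : IsIntegral Nz x := by
    refine ⟨Polynomial.X ^ p - Polynomial.C ⟨z, hzNz⟩, Polynomial.monic_X_pow_sub_C _ hp.out.ne_zero, ?_⟩
    rw [Polynomial.eval₂_sub, Polynomial.eval₂_X_pow, Polynomial.eval₂_C]; exact sub_self _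
  have hdegNz : Subfield.relfinrank Nz Nx = p := by
    have hNxeq' : Nx = Subfield.closure ((Nz : Set Ω) ∪ {x}) := by
      apply le_antisymm
      · exact Subfield.closure_le.mpr (Set.union_subset (fun c hc => Subfield.subset_closure (Or.inl (hNNz hc)))
          (Set.singleton_subset_iff.mpr (Subfield.subset_closure (Or.inr rfl))))
      · exact Subfield.closure_le.mpr (Set.union_subset hNzNx (Set.singleton_subset_iff.mpr hxNx))
    rw [hNxeq', relfinrank_closure_singleton Nz hxNz_int]
    -- the minimal polynomial of `x` over `N(z)` is `(X - x)^j`, `j ≤ p`, and `j = p`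
    set m : Polynomial Nz := minpoly Nz x with hmdef
    have hmmon : m.Monic := minpoly.monic hxNz_int
    have hmdvd : m.map (algebraMap Nz Ω) ∣ (Polynomial.X - Polynomial.C x) ^ p := by
      have h1 : m ∣ Polynomial.X ^ p - Polynomial.C ⟨z, hzNz⟩ :=
        minpoly.dvd Nz x (by rw [map_sub, map_pow, aeval_X, aeval_C]; exact sub_self _)
      have h2 := Polynomial.map_dvd (algebraMap Nz Ω) h1
      have h3 : (Polynomial.X ^ p - Polynomial.C (⟨z, hzNz⟩ : Nz)).map (algebraMap Nz Ω) =
          (Polynomial.X - Polynomial.C x) ^ p := by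
        rw [Polynomial.map_sub, Polynomial.map_pow, Polynomial.map_X, Polynomial.map_C, sub_pow_char,
          ← Polynomial.C_pow]
        rfl
      rwa [h3] at h2
    obtain ⟨j, hjp, hassoc⟩ := (dvd_prime_pow (Polynomial.prime_X_sub_C x) p).mp hmdvd
    have hmeq : m.map (algebraMap Nz Ω) = (Polynomial.X - Polynomial.C x) ^ j :=
      Polynomial.eq_of_monic_of_associated (hmmon.map _) ((Polynomial.monic_X_sub_C x).pow j) hassoc
    have hjdeg : m.natDegree = j := by
      rw [← Polynomial.natDegree_map (algebraMap Nz Ω), hmeq, Polynomial.natDegree_pow,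
        Polynomial.natDegree_X_sub_C, mul_one]
    have hj1 : 1 ≤ j := hjdeg ▸ minpoly.natDegree_pos hxNz_int
    rcases Nat.lt_or_ge j p with hjlt | hjge
    · -- coefficient of `X^(j-1)` in `(X - x)^j` is `-x·j ∈ N(z)`, forcing `x ∈ N(z)`
      exfalso
      have hcoef : ((Polynomial.X - Polynomial.C x) ^ j).coeff (j - 1) = (-x) * (j : Ω) := by
        have hXC : (Polynomial.X - Polynomial.C x : Polynomial Ω) = Polynomial.X + Polynomial.C (-x) := by
          rw [Polynomial.C_neg, sub_eq_add_neg]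
        rw [hXC, Polynomial.coeff_X_add_C_pow, show j - (j - 1) = 1 by omega, pow_one,
          Nat.choose_symm hj1, Nat.choose_one_right]
      have hmem : ((Polynomial.X - Polynomial.C x) ^ j).coeff (j - 1) ∈ Nz := by
        rw [← hmeq, Polynomial.coeff_map]
        exact (m.coeff (j - 1)).2
      rw [hcoef] at hmem
      have hj0 : (j : Ω) ≠ 0 := by
        rw [ne_eq, CharP.cast_eq_zero_iff Ω p j]
        exact Nat.not_dvd_of_pos_of_lt (by omega) hjlt
      have hxmem : x = -((-x) * (j : Ω) / (j : Ω)) := by field_simp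
      apply hxNz
      rw [hxmem]
      exact neg_mem (div_mem hmem (natCast_mem Nz j))
    · exact hjdeg.trans (le_antisymm hjp hjge)
  -- (e) `N ⊆ N(z) ⊆ M₁ = K(z)^h`
  have hNzM₁ : Nz ≤ M₁ := by
    refine le_of_relfinrank_mul hM₁Nz hNzM hdegM_pos hdegM_le hdegM.symm.symm ?_
    rw [← hNxeq]; exact hdegNz
  have hyM₁ : y ∈ M₁ := hNzM₁ (hNNz hyN)
  -- (f) contradiction with `𝐡_K(x:y) = 1`
  have hzt : Transcendental K z := fun h => hxt (IsAlgebraic.of_pow hp.out.pos (by rw [← hzdef]; exact h))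
  obtain ⟨htransz, himmz, hr1z, h3z⟩ := kaplansky_of_split V p hKM hK hperf hr1 hM hrel himm hzM hzt
  have hzK : z ∉ K := not_mem_of_forall_eval_eq_zero K htransz
  have hvalz := himmz.1
  have hresz := hres_of_isImmediateOver V himmz
  -- a threshold `t ∈ K` with `|t| = β |e| < |g(x) - b|` for all `b ∈ K`
  obtain ⟨e, heK, he0, hefar⟩ := hex
  have hga₀ : V.valuation (g.eval x - g.eval a₀) = β * V.valuation (x - a₀) := by
    rw [hlin a₀ ha₀K le_rfl, pow_one]
  have hga₀0 : g.eval x - g.eval a₀ ≠ 0 := by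
    rw [← Valuation.ne_zero_iff V.valuation, hga₀]; exact mul_ne_zero hβ (hxc0 a₀ ha₀K)
  have hga₀Kx : g.eval x - g.eval a₀ ∈ Kx :=
    sub_mem (eval_mem_subfield_of_coeff_mem (fun k => hKKx (hgK k)) hxKx)
      (hKKx (eval_mem_subfield_of_coeff_mem hgK ha₀K))
  obtain ⟨w₁, hw₁K, hw₁⟩ := hvalx _ hga₀Kx hga₀0
  obtain ⟨w₂, hw₂K, hw₂⟩ := hvalx _ (sub_mem hxKx (hKKx ha₀K)) (sub_ne_zero.mpr fun h => hxK (h ▸ ha₀K))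
  have hw₂0 : V.valuation w₂ ≠ 0 := by rw [← hw₂]; exact hxc0 a₀ ha₀K
  have hβeq : β = V.valuation (w₁ / w₂) := by
    rw [map_div₀, ← hw₁, ← hw₂, hga₀, mul_div_assoc, div_self (hxc0 a₀ ha₀K), mul_one]
  set t : Ω := w₁ / w₂ * e with htdef
  have htK : t ∈ K := mul_mem (div_mem hw₁K hw₂K) heK
  have hvt : V.valuation t = β * V.valuation e := by rw [htdef, map_mul, ← hβeq]
  have ht0 : t ≠ 0 := by
    rw [← Valuation.ne_zero_iff V.valuation, hvt]
    exact mul_ne_zero hβ ((Valuation.ne_zero_iff _).mpr he0)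
  have hgdeg : 0 < g.natDegree := by
    by_contra h0
    obtain ⟨c₀, hc₀⟩ := natDegree_eq_zero.mp (Nat.eq_zero_of_not_pos h0)
    apply hga₀0
    rw [← hc₀, eval_C, eval_C, sub_self]
  have htfar : ∀ b ∈ K, V.valuation t < V.valuation (g.eval x - b) := by
    intro b hbK
    obtain ⟨c, hcK, hcle, hclt⟩ := exists_valuation_eval_sub_eval_lt V K htransx hvalx hresx h3x hgK hgdeg hbK ha₀K
    calc V.valuation t = β * V.valuation e := hvt
      _ ≤ β * V.valuation (x - c) := mul_le_mul' le_rfl (hefar c hcK)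
      _ = V.valuation (g.eval x - g.eval c) := by rw [hlin c hcK hcle, pow_one]
      _ < V.valuation (g.eval x - b) := hclt
  -- density in `K(z)^h`: `|y - h(z)| < |t|` for a polynomial `h` over `K`
  obtain ⟨Pg, hPgK, hPg⟩ := exists_polynomial_valuation_sub_lt_of_mem_henselization V K hzK hvalz hresz h3z
    hr1z hyM₁ (hKKz htK) ht0
  set f' : Polynomial Ω := Polynomial.expand Ω p Pg with hf'def
  have hf'K : ∀ k, f'.coeff k ∈ K := fun k => by
    rw [hf'def, Polynomial.coeff_expand hp.out.pos]
    split_ifs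
    · exact hPgK _
    · exact K.zero_mem
  have hf'eval : ∀ r : Ω, f'.eval r = Pg.eval (r ^ p) := fun r => by rw [hf'def, Polynomial.expand_eval]
  -- `f'(x)` is as close to `g(x)` as it gets from `K`
  have hclose : ∀ b ∈ K, V.valuation (g.eval x - f'.eval x) ≤ V.valuation (g.eval x - b) := by
    intro b hbK
    have h1 : V.valuation (g.eval x - b) = V.valuation (y - b) := by
      have hid : g.eval x - b = (y - b) - (y - g.eval x) := by ring
      rw [hid, Valuation.map_sub_eq_of_lt_left _ (hgood b hbK)]
    have h2 : V.valuation (g.eval x - y) < V.valuation (g.eval x - b) := by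
      rw [← Valuation.map_neg, neg_sub, h1]; exact hgood b hbK
    have h3 : V.valuation (y - f'.eval x) < V.valuation (g.eval x - b) := by
      rw [hf'eval, ← hzdef]; exact lt_trans hPg (htfar b hbK)
    have hid : g.eval x - f'.eval x = (g.eval x - y) + (y - f'.eval x) := by ring
    rw [hid]
    exact (Valuation.map_add_lt _ h2 h3).le
  obtain ⟨a₁, ha₁K, hf'lin⟩ := approximationDegree_congr V K hxK hvalx hresx h3x hgK hf'K hclose hβ
    one_ne_zero ha₀K hlin
  -- `h` is non-constant
  have hPgdeg : 0 < Pg.natDegree := by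
    by_contra h0
    obtain ⟨c₀, hc₀⟩ := natDegree_eq_zero.mp (Nat.eq_zero_of_not_pos h0)
    have h1 := hf'lin a₁ ha₁K le_rfl
    rw [hf'eval, hf'eval, ← hc₀, eval_C, eval_C, sub_self, map_zero, pow_one] at h1
    exact mul_ne_zero hβ (hxc0 a₁ ha₁K) h1.symm
  -- the relative approximation degree of `h` at `z`
  obtain ⟨hh, hh1, -, β', hβ', a₂, ha₂K, hPglin⟩ := exists_approximationDegree V K hzK hvalz hresz h3z hPgK hPgdeg
  obtain ⟨a₃, ha₃K, ha₃⟩ := hperf a₂ ha₂K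
  -- a common centre
  obtain ⟨a₄, ha₄K, ha₄₁, ha₄₃⟩ : ∃ a₄ ∈ K, V.valuation (x - a₄) ≤ V.valuation (x - a₁) ∧
      V.valuation (x - a₄) ≤ V.valuation (x - a₃) := by
    rcases le_total (V.valuation (x - a₁)) (V.valuation (x - a₃)) with h | h
    · exact ⟨a₁, ha₁K, le_rfl, h⟩
    · exact ⟨a₃, ha₃K, h, le_rfl⟩
  have hboth : ∀ c ∈ K, V.valuation (x - c) ≤ V.valuation (x - a₄) →
      β * V.valuation (x - c) ^ 1 = β' * V.valuation (x - c) ^ (p * hh) := by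
    intro c hcK hle
    have hcp : c ^ p ∈ K := pow_mem hcK p
    have hzc : z - c ^ p = (x - c) ^ p := by rw [hzdef, sub_pow_char]
    have hclose₂ : V.valuation (z - c ^ p) ≤ V.valuation (z - a₂) := by
      rw [hzc, ← ha₃, show z - a₃ ^ p = (x - a₃) ^ p by rw [hzdef, sub_pow_char], map_pow, map_pow]
      exact pow_le_pow_left₀ zero_le (hle.trans ha₄₃) p
    have h1 := (hPglin (c ^ p) hcp hclose₂).2.2
    have h2 := hf'lin c hcK (hle.trans ha₄₁)
    rw [hf'eval, hf'eval, ← hzdef, h1, hzc, map_pow, ← pow_mul] at h2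
    exact h2.symm
  have huniq := (approximationDegree_unique V K hxK hvalx hresx ha₄K hβ hβ' hboth).1
  -- `1 = p * hh` is absurd
  have h2 : 2 * 1 ≤ p * hh := Nat.mul_le_mul hp1 hh1
  have hne1 : p * hh ≠ 1 := Nat.ne_of_gt (lt_of_lt_of_le (by norm_num) h2)
  exact hne1 huniq.symm

end Split



/-! ### Kuhlmann–Vlahu 2014, Thm. 14.5 with Lemma 14.2, for a tame root layer -/

section Main

variable {C E : Subfield Ω} (hCE : C ≤ E) (P : Polynomial C)

omit [IsAlgClosed Ω] in
/-- Transcendence from the polynomial form. [folklore] -/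
theorem transcendental_of_forall_eval_eq_zero {K : Subfield Ω} {x : Ω}
    (h : ∀ Q : Polynomial Ω, (∀ k, Q.coeff k ∈ K) → Q.eval x = 0 → Q = 0) :
    Transcendental K x := by
  rintro ⟨Q', hQ'0, hQ'x⟩
  apply hQ'0
  have h1 : Q'.map (algebraMap K Ω) = 0 := by
    refine h _ (fun k => ?_) ?_
    · rw [Polynomial.coeff_map]; exact (Q'.coeff k).2
    · rwa [Polynomial.eval_map, ← Polynomial.aeval_def]
  exact (Polynomial.map_eq_zero_iff (algebraMap K Ω).injective).mp h1

include hCE in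
/-- **Kuhlmann–Vlahu 2014, Thm. 14.5 (pull-down of henselian rationality) with Lemma 14.2, for
a tame root layer.** In the setting of `TameDescentTrace.lean` — `C ≤ E ≤ Ω` (`Ω` algebraically
closed of characteristic `p`, residue characteristic `p`), `C` perfect, henselian, of rank one,
algebraically closed in the henselian `E`, `(E|C, V)` immediate; `L = C(roots of P)` a root
layer with trivial ramification group; `M = E(roots of P)`; `x ∈ M` transcendental over `C`,
not a limit of elements of `L`, with `M ⊆ L(x)^h` — there is `y ∈ E`, transcendental over `C`,
with **`E ≤ C(y)^h`**: henselian rationality of `E·L = L(x)^h` over the tame `L` descends to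
`E` over `C`. PROVED along the printed lines: `y = Tr(d·x)` with `𝐡_L(x:y) = 1`
(`exists_good_trace`); `x ∈ L(y)^h` (Prop. 10.5, `mem_henselization_of_degree_one`, with
`isSeparable_of_good_approximant`), so `M = L(y)^h = C(y)^h(roots of P)`; and Lemma 14.2:
`[M : E] = [L : C] = [C(y)^h(roots P) : C(y)^h]` (`finrank_adjoin_rootSet_top_eq`) forces
`E = C(y)^h` in the tower `C(y)^h ≤ E ≤ M`.
[cite: KuhlmannVlahu2014, Thm. 14.5] [cite: Temkin2013, Thm. 3.2.3 (Step 1)] -/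
theorem le_henselization_of_rootLayer (p : ℕ) [hp : Fact p.Prime] [CharP Ω p]
    [CharP (ResidueField V) p]
    (hperf : ∀ y ∈ C, ∃ b ∈ C, b ^ p = y) (hrel : ∀ a ∈ E, IsAlgebraic C a → a ∈ C)
    (hC : IsHenselianField C (V.comap (algebraMap C Ω)))
    (hE : IsHenselianField E (V.comap (algebraMap E Ω))) (hr1 : IsRankOneValued V C)
    (himm : IsImmediateOver V C E)
    (hram : ramificationGroupIn V (IntermediateField.adjoin C (P.rootSet Ω)) = ⊥)
    {x : Ω} (hxM : x ∈ (IntermediateField.adjoin E (P.rootSet Ω)).toSubfield)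
    (hxt : Transcendental C x)
    (hex : ∃ e ∈ (IntermediateField.adjoin C (P.rootSet Ω)).toSubfield, e ≠ 0 ∧
      ∀ b ∈ (IntermediateField.adjoin C (P.rootSet Ω)).toSubfield,
        V.valuation e ≤ V.valuation (x - b))
    (hMx : ((IntermediateField.adjoin E (P.rootSet Ω) : IntermediateField E Ω) : Set Ω) ⊆
      henselization V (Subfield.closure
        (((IntermediateField.adjoin C (P.rootSet Ω)).toSubfield : Set Ω) ∪ {x}))) :
    ∃ y ∈ E, Transcendental C y ∧
      E ≤ henselization V (Subfield.closure ((C : Set Ω) ∪ {y})) := by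
  classical
  haveI : PerfectField C := perfectField_of_forall_exists_pow_eq p hperf
  haveI : FiniteDimensional C (IntermediateField.adjoin C (P.rootSet Ω)) :=
    finiteDimensional_adjoin_rootSet_subfield P
  obtain ⟨y, hyE, htransy, g, hgK, hgood, β, hβ, a₀, ha₀L, hlin⟩ :=
    exists_good_trace V hCE P p hperf hrel hC hE hr1 himm hram hxM hxt hex hMx
  -- bookkeeping for `L ≤ M`
  have hLM : (IntermediateField.adjoin C (P.rootSet Ω)).toSubfield ≤
      (IntermediateField.adjoin E (P.rootSet Ω)).toSubfield := toSubfield_adjoin_rootSet_le hCE P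
  have hCL : C ≤ (IntermediateField.adjoin C (P.rootSet Ω)).toSubfield := le_toSubfield_adjoin_rootSet P
  have hEM : E ≤ (IntermediateField.adjoin E (P.rootSet Ω)).toSubfield :=
    le_toSubfield_adjoin_rootSet_top P
  have hL : IsHenselianField (IntermediateField.adjoin C (P.rootSet Ω)).toSubfield
      (V.comap (algebraMap (IntermediateField.adjoin C (P.rootSet Ω)).toSubfield Ω)) :=
    isHenselianField_toSubfield_adjoin_rootSet V P hC
  have hM : IsHenselianField (IntermediateField.adjoin E (P.rootSet Ω)).toSubfield
      (V.comap (algebraMap (IntermediateField.adjoin E (P.rootSet Ω)).toSubfield Ω)) :=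
    isHenselianField_toSubfield_adjoin_rootSet_top V hCE P hE
  have hperfL : ∀ w ∈ (IntermediateField.adjoin C (P.rootSet Ω)).toSubfield,
      ∃ b ∈ (IntermediateField.adjoin C (P.rootSet Ω)).toSubfield, b ^ p = w := fun w hw =>
    exists_pow_eq_of_mem_toSubfield_adjoin_rootSet P p hperf hw
  have hrelM : ∀ a ∈ (IntermediateField.adjoin E (P.rootSet Ω)).toSubfield,
      IsAlgebraic (IntermediateField.adjoin C (P.rootSet Ω)).toSubfield a →
        a ∈ (IntermediateField.adjoin C (P.rootSet Ω)).toSubfield := fun a haM ha =>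
    mem_toSubfield_adjoin_rootSet_of_isAlgebraic hCE P p hperf hrel haM ha
  have himmM := isImmediateOver_rootLayer V hCE P p hperf hrel hE himm
  have hr1L : IsRankOneValued V (IntermediateField.adjoin C (P.rootSet Ω)).toSubfield :=
    IsRankOneValued.of_algebraic V hCL hr1 fun _ hw => isAlgebraic_of_mem_toSubfield_adjoin_rootSet P hw
  have hxtL : Transcendental (IntermediateField.adjoin C (P.rootSet Ω)).toSubfield x := fun hxa =>
    hxt (isAlgebraic_trans_subfield hCL (fun _ hw => isAlgebraic_of_mem_toSubfield_adjoin_rootSet P hw) hxa)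
  have hyM : y ∈ (IntermediateField.adjoin E (P.rootSet Ω)).toSubfield := hEM hyE
  have hMx' : (IntermediateField.adjoin E (P.rootSet Ω)).toSubfield ≤ henselization V (Subfield.closure
      (((IntermediateField.adjoin C (P.rootSet Ω)).toSubfield : Set Ω) ∪ {x})) := fun w hw => hMx hw
  -- Prop. 10.5: `x ∈ L(y)^h`
  have hsep := isSeparable_of_good_approximant V p hLM hL hperfL hr1L hM hrelM himmM hxM hxtL hMx' hyM
    hgK hgood hβ ha₀L hlin hex
  obtain ⟨htransx, himmx, hr1x, h3x⟩ := kaplansky_of_split V p hLM hL hperfL hr1L hM hrelM himmM hxM hxtL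
  have hLyM : Subfield.closure ((((IntermediateField.adjoin C (P.rootSet Ω)).toSubfield : Set Ω)) ∪ {y}) ≤
      (IntermediateField.adjoin E (P.rootSet Ω)).toSubfield :=
    Subfield.closure_le.mpr (Set.union_subset hLM (Set.singleton_subset_iff.mpr hyM))
  have himmy := himmM.mono_right hLyM
  have hyx : y ∈ henselization V (Subfield.closure
      (((IntermediateField.adjoin C (P.rootSet Ω)).toSubfield : Set Ω) ∪ {x})) := hMx' hyM
  have hxN : x ∈ henselization V (Subfield.closure
      ((((IntermediateField.adjoin C (P.rootSet Ω)).toSubfield : Set Ω)) ∪ {y})) :=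
    mem_henselization_of_degree_one V _ htransx himmx h3x hr1x htransy himmy hyx hgK hgood hβ ha₀L hlin hsep
  -- hence `M ⊆ L(y)^h`
  set N : Subfield Ω := henselization V (Subfield.closure
    ((((IntermediateField.adjoin C (P.rootSet Ω)).toSubfield : Set Ω)) ∪ {y})) with hNdef
  have hN : IsHenselianField N (V.comap (algebraMap N Ω)) := Kuhlmann2010HenselizationIsHenselian_holds Ω V _
  have hLyN : Subfield.closure ((((IntermediateField.adjoin C (P.rootSet Ω)).toSubfield : Set Ω)) ∪ {y}) ≤ N :=
    le_henselization V _
  have hLN : (IntermediateField.adjoin C (P.rootSet Ω)).toSubfield ≤ N := fun w hw =>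
    hLyN (Subfield.subset_closure (Or.inl hw))
  have hyN : y ∈ N := hLyN (Subfield.subset_closure (Or.inr rfl))
  have hMN : (IntermediateField.adjoin E (P.rootSet Ω)).toSubfield ≤ N :=
    hMx'.trans (henselization_le_of_isHenselianField V _
      (Subfield.closure_le.mpr (Set.union_subset hLN (Set.singleton_subset_iff.mpr hxN))) hN)
  -- Lemma 14.2: `N₀ = C(y)^h ≤ E`, and `M = N₀(roots P)`
  set N₀ : Subfield Ω := henselization V (Subfield.closure ((C : Set Ω) ∪ {y})) with hN₀def
  have hCyE : Subfield.closure ((C : Set Ω) ∪ {y}) ≤ E :=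
    Subfield.closure_le.mpr (Set.union_subset hCE (Set.singleton_subset_iff.mpr hyE))
  have hN₀E : N₀ ≤ E := henselization_le_of_isHenselianField V _ hCyE hE
  have hCN₀ : C ≤ N₀ := fun c hc => le_henselization V _ (Subfield.subset_closure (Or.inl hc))
  have hyN₀ : y ∈ N₀ := le_henselization V _ (Subfield.subset_closure (Or.inr rfl))
  have hN₀ : IsHenselianField N₀ (V.comap (algebraMap N₀ Ω)) := Kuhlmann2010HenselizationIsHenselian_holds Ω V _
  have hrelN₀ : ∀ a ∈ N₀, IsAlgebraic C a → a ∈ C := fun a ha halg => hrel a (hN₀E ha) halg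
  have hX : IsHenselianField (IntermediateField.adjoin N₀ (P.rootSet Ω)).toSubfield
      (V.comap (algebraMap (IntermediateField.adjoin N₀ (P.rootSet Ω)).toSubfield Ω)) :=
    isHenselianField_toSubfield_adjoin_rootSet_top V hCN₀ P hN₀
  have hXM : (IntermediateField.adjoin N₀ (P.rootSet Ω)).toSubfield ≤
      (IntermediateField.adjoin E (P.rootSet Ω)).toSubfield := by
    intro w hw
    have hw' : w ∈ Subfield.closure ((N₀ : Set Ω) ∪ P.rootSet Ω) := by
      rwa [← mem_adjoin_subfield_iff]
    refine (Subfield.closure_le (t := (IntermediateField.adjoin E (P.rootSet Ω)).toSubfield)).mpr ?_ hw'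
    exact Set.union_subset (hN₀E.trans hEM) (IntermediateField.subset_adjoin E _)
  have hNX : N ≤ (IntermediateField.adjoin N₀ (P.rootSet Ω)).toSubfield := by
    refine henselization_le_of_isHenselianField V _ ?_ hX
    refine Subfield.closure_le.mpr (Set.union_subset (fun w hw => coe_adjoin_rootSet_subset hCN₀ P hw) ?_)
    exact Set.singleton_subset_iff.mpr ((IntermediateField.adjoin N₀ (P.rootSet Ω)).algebraMap_mem ⟨y, hyN₀⟩)
  have hXeq : (IntermediateField.adjoin N₀ (P.rootSet Ω)).toSubfield =
      (IntermediateField.adjoin E (P.rootSet Ω)).toSubfield := le_antisymm hXM (hMN.trans hNX)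
  -- degrees
  set n : ℕ := finrank C (IntermediateField.adjoin C (P.rootSet Ω)) with hndef
  have hn : 0 < n := Module.finrank_pos
  have hN₀M : N₀ ≤ (IntermediateField.adjoin E (P.rootSet Ω)).toSubfield := hN₀E.trans hEM
  have h1 : Subfield.relfinrank N₀ (IntermediateField.adjoin E (P.rootSet Ω)).toSubfield = n := by
    rw [Subfield.relfinrank_eq_finrank_of_le hN₀M]
    have heq : Subfield.extendScalars hN₀M = IntermediateField.adjoin N₀ (P.rootSet Ω) := by
      apply IntermediateField.ext
      intro w
      rw [Subfield.mem_extendScalars, ← IntermediateField.mem_toSubfield (IntermediateField.adjoin N₀ (P.rootSet Ω)),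
        hXeq]
    rw [heq, finrank_adjoin_rootSet_top_eq hCN₀ P hrelN₀]
  have h2 : Subfield.relfinrank E (IntermediateField.adjoin E (P.rootSet Ω)).toSubfield = n := by
    rw [Subfield.relfinrank_eq_finrank_of_le hEM]
    have heq : Subfield.extendScalars hEM = IntermediateField.adjoin E (P.rootSet Ω) := by
      apply IntermediateField.ext
      intro w
      rw [Subfield.mem_extendScalars, ← IntermediateField.mem_toSubfield]
    rw [heq, finrank_adjoin_rootSet_top_eq hCE P hrel]
  have hEN₀ : E ≤ N₀ := le_of_relfinrank_mul hN₀E hEM hn le_rfl h1 h2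
  -- transcendence of `y` over `C`
  have hytL := transcendental_of_forall_eval_eq_zero htransy
  have hyt : Transcendental C y := fun h => hytL (isAlgebraic_of_subfield_le hCL h)
  exact ⟨y, hyE, hyt, hEN₀⟩

end Main

end Literature.AlgebraicGeometry.Resolution

end
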